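import Literature.NumberTheory.EllipticCurves.TwoDescentLocalTwo
import Literature.NumberTheory.EllipticCurves.TwoDescentLocalOdd
import Summits.BirchSwinnertonDyer.BirchSwinnertonDyer.Theorems.Rank2ObservatoryTwoDescentLocalTwoImageTable
import Summits.BirchSwinnertonDyer.BirchSwinnertonDyer.Theorems.Rank2ObservatoryTwoDescentLocalTwoImage00
import HarnessLib

/-!
# Rank-2 observatory — the `2`-adic image of the complete `2`-descent, configuration `(1,1,m)`

HONEST FRAMING: per-curve certified theorems and census instruments; no claim on BSD in rank ≥ 2.

Let `y² = (x - e₁)(x - e₂)(x - e₃)` with `e₂ - e₁ = 2a₁`, `a₁` odd, `e₃ - e₂ = 2^m u`, `u` odd,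
`m ≥ 2` (so `v₂(e₁ - e₂) = v₂(e₁ - e₃) = 1`, `v₂(e₂ - e₃) = m`, `e₃ - e₁ = 2b₁`,
`b₁ = a₁ + 2^(m-1) u`). For every rational point with `y ≠ 0` the six bits `(v₂ mod 2, χ₄, χ₈)` of
`x - e₁`, `x - e₂` lie in the decision table `w11 m a₁ u` of
`Rank2ObservatoryTwoDescentLocalTwoImageTable.lean` (`w11_of_point`). Case analysis on
`v = v₂(x - e₁)`: `v < 0` (class trivial), `v ≥ 2` (even; the other two factors have valuation `1`),
`v = 1` (then `t = v₂(x - e₂) ≥ 2`; `t < m` is impossible by parity, `t > m` with `t - m` odd, or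
`t = m` with `v₂(x - e₃) - m` odd), `v = 0` (three units), residues modulo `8` throughout.

## References

* J. H. Silverman, *The Arithmetic of Elliptic Curves*, 2nd ed., GTM 106 (2009), Prop. X.1.4,
  Example X.1.5. [SilvermanAEC2009]
* J. E. Cremona, *Algorithms for Modular Elliptic Curves*, 2nd ed. (1997), Sec. 3.6. [CremonaAlgorithms1997]
-/

open scoped Classical

set_option linter.dupNamespace false

namespace Summit.BirchSwinnertonDyer.BirchSwinnertonDyer.Rank2Observatory

open Literature.NumberTheory.EllipticCurves.TwoDescentLocal
open Literature.NumberTheory.EllipticCurves.KramerTwoDescent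
open Literature.Barriers.BirchSwinnertonDyer.DokchitserDokchitser2011 (two_pow_eq_zero_of_le)

variable {e₁ e₂ e₃ : ℤ} {x y : ℚ}

/-- Two `2`-adic numbers of the same valuation: `v₂(a - c) ≥ v₂(c) + 1` (or `a = c`), in the form
used below: if `v₂ a = v₂ c`, `a ≠ c`, then `v₂ c + 1 ≤ v₂ (a - c)`. [folklore] -/
theorem padicValRat_sub_of_eq_val {a c : ℚ} (ha : a ≠ 0) (hc : c ≠ 0)
    (hv : padicValRat 2 a = padicValRat 2 c) (hne : a - c ≠ 0) :
    padicValRat 2 c + 1 ≤ padicValRat 2 (a - c) := by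
  set q : ℚ := a / c with hq
  have hq0 : q ≠ 0 := div_ne_zero ha hc
  have hvq : padicValRat 2 q = 0 := by rw [hq, padicValRat.div ha hc, hv, sub_self]
  have hfac : a - c = c * (q - (1 : ℤ)) := by
    rw [hq, Int.cast_one, mul_sub, mul_div_cancel₀ _ hc, mul_one]
  have hq1 : q - (1 : ℤ) ≠ 0 := by
    intro h0; rw [h0, mul_zero] at hfac; exact hne hfac
  have := one_le_padicValRat_two_sub hq0 hvq (a := 1) (by decide) hq1
  rw [hfac, padicValRat.mul hc hq1]; omega

/-- **The `2`-adic image, configuration `(1,1,m)`.** With `e₂ - e₁ = 2a₁`, `a₁` odd,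
`e₃ - e₂ = 2^m u`, `u` odd, `m ≥ 2`: for every rational point `(x, y)`, `y ≠ 0`, of
`y² = (x - e₁)(x - e₂)(x - e₃)` the six bits `(v₂ mod 2, χ₄, χ₈)` of `x - e₁`, `x - e₂` lie in the
table `w11 m a₁ u`. [cite: SilvermanAEC2009, Prop. X.1.4, Example X.1.5] -/
theorem w11_of_point {m : ℕ} {a₁ u : ℤ} (hm : 2 ≤ m) (ha₁ : ¬ (2 : ℤ) ∣ a₁) (hu : ¬ (2 : ℤ) ∣ u)
    (h₁₂ : e₂ - e₁ = 2 * a₁) (h₂₃ : e₃ - e₂ = 2 ^ m * u) (hy : y ≠ 0)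
    (h : y ^ 2 = (x - e₁) * (x - e₂) * (x - e₃)) :
    w11 m ((a₁ : ℤ) : ZMod (2 ^ 3)) ((u : ℤ) : ZMod (2 ^ 3))
      (parityBit 2 (x - e₁), chi4 (x - e₁), chi8 (x - e₁),
        parityBit 2 (x - e₂), chi4 (x - e₂), chi8 (x - e₂)) = true := by
  obtain ⟨hd₁, hd₂, hd₃⟩ := factors_ne_zero hy h
  -- the integer data: `e₃ - e₁ = 2 b₁`, `b₁ = a₁ + 2^(m-1) u` odd
  obtain ⟨m', rfl⟩ : ∃ m', m = m' + 1 := ⟨m - 1, by omega⟩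
  have hm' : 1 ≤ m' := by omega
  set b₁ : ℤ := a₁ + 2 ^ m' * u with hb₁_def
  have h₃₁ : e₃ - e₁ = 2 * b₁ := by
    rw [hb₁_def, show e₃ - e₁ = (e₂ - e₁) + (e₃ - e₂) by ring, h₁₂, h₂₃, pow_succ]; ring
  have hb₁ : ¬ (2 : ℤ) ∣ b₁ := by
    rw [hb₁_def]; intro hd
    exact ha₁ ((dvd_add_left (dvd_mul_of_dvd_left (dvd_pow_self 2 (by omega)) u)).mp hd)
  -- rational constants: values, valuations, residues
  obtain ⟨ha0, hva, hra⟩ := twoPowMul_facts (m := 1) ha₁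
  have h12Q : (e₂ : ℚ) - e₁ = (2 : ℚ) ^ 1 * a₁ := by rw [pow_one]; exact_mod_cast h₁₂
  rw [← h12Q] at ha0 hva hra
  obtain ⟨hb0, hvb, hrb⟩ := twoPowMul_facts (m := 1) hb₁
  have h13Q : (e₃ : ℚ) - e₁ = (2 : ℚ) ^ 1 * b₁ := by rw [pow_one]; exact_mod_cast h₃₁
  rw [← h13Q] at hb0 hvb hrb
  obtain ⟨hc0, hvc, hrc⟩ := twoPowMul_facts (m := m' + 1) hu
  have h23Q : (e₃ : ℚ) - e₂ = (2 : ℚ) ^ (m' + 1) * u := by exact_mod_cast h₂₃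
  rw [← h23Q] at hc0 hvc hrc
  have neg_facts : ∀ {p q : ℤ} {w : ℤ} {n : ℕ}, ((p : ℚ) - q) ≠ 0 → padicValRat 2 ((p : ℚ) - q) = n →
      res8 ((p : ℚ) - q) = ((w : ℤ) : ZMod (2 ^ 3)) →
      ((q : ℚ) - p) ≠ 0 ∧ padicValRat 2 ((q : ℚ) - p) = n ∧ res8 ((q : ℚ) - p) = -((w : ℤ) : ZMod (2 ^ 3)) := by
    intro p q w n h0 hv hr
    have hneg : (q : ℚ) - p = (-1 : ℚ) * ((p : ℚ) - q) := by ring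
    refine ⟨by rw [hneg]; exact mul_ne_zero (by norm_num) h0, by rw [hneg, neg_one_mul, padicValRat.neg, hv], ?_⟩
    rw [hneg, res8_mul (by norm_num) h0, hr, show (-1 : ℚ) = ((-1 : ℤ) : ℚ) by norm_num, res8_intCast (by decide)]
    push_cast; ring
  obtain ⟨ha0', hva', hra'⟩ := neg_facts ha0 hva hra
  obtain ⟨hb0', hvb', hrb'⟩ := neg_facts hb0 hvb hrb
  obtain ⟨hc0', hvc', hrc'⟩ := neg_facts hc0 hvc hrc
  have hab : ((b₁ : ℤ) : ZMod (2 ^ 3)) = ((a₁ : ℤ) : ZMod (2 ^ 3)) + 2 ^ (m' + 1 - 1) * ((u : ℤ) : ZMod (2 ^ 3)) := by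
    rw [hb₁_def, Nat.add_sub_cancel]; push_cast; ring
  set a : ZMod (2 ^ 3) := ((a₁ : ℤ) : ZMod (2 ^ 3)) with ha_def
  set u8 : ZMod (2 ^ 3) := ((u : ℤ) : ZMod (2 ^ 3)) with hu8_def
  set b : ZMod (2 ^ 3) := ((b₁ : ℤ) : ZMod (2 ^ 3)) with hb_def
  -- the product of the three residues is `res8 (y²) = 1`
  have hprod : res8 (x - (e₁ : ℚ)) * res8 (x - (e₂ : ℚ)) * res8 (x - (e₃ : ℚ)) = 1 := by
    have h1 : res8 (y ^ 2) = res8 (x - (e₁ : ℚ)) * res8 (x - (e₂ : ℚ)) * res8 (x - (e₃ : ℚ)) := by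
      rw [h, res8_mul (mul_ne_zero hd₁ hd₂) hd₃, res8_mul hd₁ hd₂]
    rw [← h1, res8_sq, sq, res8_mul_self hy]
  have hrr₁ : res8 (x - (e₁ : ℚ)) * res8 (x - (e₁ : ℚ)) = 1 := res8_mul_self hd₁
  have hrr₂ : res8 (x - (e₂ : ℚ)) * res8 (x - (e₂ : ℚ)) = 1 := res8_mul_self hd₂
  have hrr₃ : res8 (x - (e₃ : ℚ)) * res8 (x - (e₃ : ℚ)) = 1 := res8_mul_self hd₃
  have hsum := even_sum_padicValRat (p := 2) hy h
  set v := padicValRat 2 (x - e₁) with hv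
  set t := padicValRat 2 (x - e₂) with ht
  have hx₂ : x - (e₂ : ℚ) = (x - e₁) + ((e₁ : ℚ) - e₂) := by ring
  have hx₂' : x - (e₂ : ℚ) = ((e₁ : ℚ) - e₂) + (x - e₁) := by ring
  have hx₃ : x - (e₃ : ℚ) = (x - e₁) + ((e₁ : ℚ) - e₃) := by ring
  have hx₃' : x - (e₃ : ℚ) = ((e₁ : ℚ) - e₃) + (x - e₁) := by ring
  have GOAL : ∀ {v₁ : ℕ} {r₁ : ZMod (2 ^ 3)} {v₂ : ℕ} {r₂ : ZMod (2 ^ 3)},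
      parityBit 2 (x - (e₁ : ℚ)) = (v₁ : ZMod 2) → res8 (x - (e₁ : ℚ)) = r₁ →
      parityBit 2 (x - (e₂ : ℚ)) = (v₂ : ZMod 2) → res8 (x - (e₂ : ℚ)) = r₂ →
      w11 (m' + 1) a u8 (twoBits v₁ r₁ v₂ r₂) = true →
      w11 (m' + 1) a u8 (parityBit 2 (x - e₁), chi4 (x - e₁), chi8 (x - e₁),
        parityBit 2 (x - e₂), chi4 (x - e₂), chi8 (x - e₂)) = true := by
    intro v₁ r₁ v₂ r₂ hp₁ hr₁ hp₂ hr₂ hw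
    simp only [chi4, chi8, hp₁, hr₁, hp₂, hr₂]; exact hw
  rcases lt_trichotomy v 0 with hneg | hzero | hpos
  · -- (A) `v < 0`: all three factors have valuation `v` (even) and the same residue
    have hv₂ : t = v := by
      rw [ht, hx₂]; exact (padicValRat_add_eq_left hd₁ (Or.inr (by rw [hva']; omega))).2
    have hv₃ : padicValRat 2 (x - (e₃ : ℚ)) = v := by
      rw [hx₃]; exact (padicValRat_add_eq_left hd₁ (Or.inr (by rw [hvb']; omega))).2
    rw [hv₂, hv₃] at hsum
    obtain ⟨j, hj⟩ := hsum
    obtain ⟨k, hk⟩ := Int.eq_ofNat_of_zero_le (show 0 ≤ -v by omega)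
    have hk2 : 2 ≤ k := by omega
    have hres₂ : res8 (x - (e₂ : ℚ)) = res8 (x - (e₁ : ℚ)) := by
      conv_lhs => rw [hx₂]
      rw [res8_add_of_eq hd₁ (k := k + 1) (by omega) (by rw [hva', ← hv]; push_cast; omega),
        two_pow_eq_zero_of_le (by omega), zero_mul, add_zero]
    have hres₃ : res8 (x - (e₃ : ℚ)) = res8 (x - (e₁ : ℚ)) := by
      conv_lhs => rw [hx₃]
      rw [res8_add_of_eq hd₁ (k := k + 1) (by omega) (by rw [hvb', ← hv]; push_cast; omega),
        two_pow_eq_zero_of_le (by omega), zero_mul, add_zero]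
    rw [hres₂, hres₃] at hprod
    refine GOAL (v₁ := 0) (v₂ := 0) (by rw [Nat.cast_zero]; exact parityBit_eq_zero_iff.mpr ⟨j - v, by omega⟩)
      rfl (by rw [Nat.cast_zero]; exact parityBit_eq_zero_iff.mpr ⟨j - v, by omega⟩) hres₂ ?_
    exact w11_of_A hrr₁ hprod
  · -- (C) `v = 0`: three units
    have hv₂ : t = 0 := by
      rw [ht, hx₂, (padicValRat_add_eq_left hd₁ (Or.inr (by rw [hva', ← hv, hzero]; norm_num))).2, ← hv, hzero]
    have hres₂ : res8 (x - (e₂ : ℚ)) = res8 (x - (e₁ : ℚ)) + 2 * -a := by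
      conv_lhs => rw [hx₂]
      rw [res8_add_of_eq hd₁ (k := 1) le_rfl (by rw [hva', ← hv, hzero]; norm_num), hra', pow_one]
    have hres₃ : res8 (x - (e₃ : ℚ)) = res8 (x - (e₁ : ℚ)) + 2 * -b := by
      conv_lhs => rw [hx₃]
      rw [res8_add_of_eq hd₁ (k := 1) le_rfl (by rw [hvb', ← hv, hzero]; norm_num), hrb', pow_one]
    rw [hres₂, hres₃] at hprod
    refine GOAL (v₁ := 0) (v₂ := 0) (by rw [Nat.cast_zero]; exact parityBit_eq_zero_iff.mpr (by rw [← hv, hzero]; exact ⟨0, rfl⟩))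
      rfl (by rw [Nat.cast_zero]; exact parityBit_eq_zero_iff.mpr (by rw [← ht, hv₂]; exact ⟨0, rfl⟩)) hres₂ ?_
    exact w11_of_C hab hrr₁ hprod
  rcases (show v = 1 ∨ 1 < v by omega) with hone | hge2
  · -- (B') `v = 1`: `t = v₂(x - e₂) ≥ 2`
    have ht2 : (1 : ℤ) + 1 ≤ t := by
      have := padicValRat_sub_of_eq_val hd₁ ha0 (by rw [← hv, hone, hva]; norm_num)
        (by rw [show x - (e₁ : ℚ) - ((e₂ : ℚ) - e₁) = x - e₂ by ring]; exact hd₂)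
      rwa [hva, show x - (e₁ : ℚ) - ((e₂ : ℚ) - e₁) = x - e₂ by ring, Nat.cast_one] at this
    obtain ⟨tn, htn⟩ := Int.eq_ofNat_of_zero_le (show 0 ≤ t by omega)
    have hp₁ : parityBit 2 (x - (e₁ : ℚ)) = ((1 : ℕ) : ZMod 2) := parityBit_two_eq_natCast (by rw [← hv, hone]; simp)
    have hx₁ : x - (e₁ : ℚ) = ((e₂ : ℚ) - e₁) + (x - e₂) := by ring
    have hy₃ : x - (e₃ : ℚ) = (x - e₂) + ((e₂ : ℚ) - e₃) := by ring
    have hy₃' : x - (e₃ : ℚ) = ((e₂ : ℚ) - e₃) + (x - e₂) := by ring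
    rcases lt_trichotomy t (m' + 1 : ℕ) with hlt | heq | hgt
    · -- `t < m`: impossible by parity
      exfalso
      have hv₃ : padicValRat 2 (x - (e₃ : ℚ)) = t := by
        rw [hy₃]; exact (padicValRat_add_eq_left hd₂ (Or.inr (by rw [hvc', ← ht]; exact hlt))).2
      rw [hone, hv₃] at hsum; obtain ⟨j, hj⟩ := hsum; omega
    · -- `t = m`: `v₂(x - e₃) = m + s`, `s` odd
      have hv₃ : (((m' + 1 : ℕ)) : ℤ) + 1 ≤ padicValRat 2 (x - (e₃ : ℚ)) := by
        have := padicValRat_sub_of_eq_val hd₂ hc0 (by rw [← ht, heq, hvc])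
          (by rw [show x - (e₂ : ℚ) - ((e₃ : ℚ) - e₂) = x - e₃ by ring]; exact hd₃)
        rwa [hvc, show x - (e₂ : ℚ) - ((e₃ : ℚ) - e₂) = x - e₃ by ring] at this
      obtain ⟨sn, hsn⟩ : ∃ sn : ℕ, padicValRat 2 (x - (e₃ : ℚ)) = (m' + 1 : ℕ) + sn := by
        obtain ⟨sn, hsn⟩ := Int.eq_ofNat_of_zero_le (show 0 ≤ padicValRat 2 (x - (e₃ : ℚ)) - (m' + 1 : ℕ) by omega)
        exact ⟨sn, by omega⟩
      rw [hone, heq, hsn] at hsum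
      obtain ⟨j, hj⟩ := hsum
      have hso : Odd sn := ⟨(j - (m' : ℤ) - 2).toNat, by push_cast at hj; omega⟩
      have hs1 : 1 ≤ sn := by obtain ⟨i, hi⟩ := hso; omega
      have hz₂ : x - (e₂ : ℚ) = ((e₃ : ℚ) - e₂) + (x - e₃) := by ring
      have hz₁ : x - (e₁ : ℚ) = ((e₃ : ℚ) - e₁) + (x - e₃) := by ring
      have hres₂ : res8 (x - (e₂ : ℚ)) = u8 + 2 ^ sn * res8 (x - (e₃ : ℚ)) := by
        rw [← hrc]; conv_lhs => rw [hz₂]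
        exact res8_add_of_eq hc0 hs1 (by rw [hvc, hsn])
      have hres₁ : res8 (x - (e₁ : ℚ)) = b + 2 ^ (m' + 1 + sn - 1) * res8 (x - (e₃ : ℚ)) := by
        rw [← hrb]; conv_lhs => rw [hz₁]
        exact res8_add_of_eq hb0 (k := m' + 1 + sn - 1) (by omega) (by rw [hvb, hsn]; push_cast; omega)
      have hp₂ : parityBit 2 (x - (e₂ : ℚ)) = ((m' + 1 : ℕ) : ZMod 2) :=
        parityBit_two_eq_natCast (by rw [← ht, heq]; simp)
      rw [hres₁, hres₂] at hprod
      exact GOAL hp₁ hres₁ hp₂ hres₂ (w11_of_C3 hab hm hso hrr₃ hprod)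
    · -- `t > m`, `t - m` odd
      have hv₃ : padicValRat 2 (x - (e₃ : ℚ)) = (m' + 1 : ℕ) := by
        rw [hy₃', (padicValRat_add_eq_left hc0' (Or.inr (by rw [hvc', ← ht]; exact hgt))).2, hvc']
      obtain ⟨sn, hsn⟩ : ∃ sn : ℕ, tn = (m' + 1) + sn := ⟨tn - (m' + 1), by omega⟩
      rw [hone, hv₃, htn, hsn] at hsum
      obtain ⟨j, hj⟩ := hsum
      have hso : Odd sn := ⟨(j - (m' : ℤ) - 2).toNat, by push_cast at hj; omega⟩
      have hs1 : 1 ≤ sn := by obtain ⟨i, hi⟩ := hso; omega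
      have hres₁ : res8 (x - (e₁ : ℚ)) = a + 2 ^ (m' + 1 + sn - 1) * res8 (x - (e₂ : ℚ)) := by
        rw [← hra]; conv_lhs => rw [hx₁]
        exact res8_add_of_eq ha0 (k := m' + 1 + sn - 1) (by omega) (by rw [hva, ← ht, htn, hsn]; push_cast; omega)
      have hres₃ : res8 (x - (e₃ : ℚ)) = -u8 + 2 ^ sn * res8 (x - (e₂ : ℚ)) := by
        rw [← hrc']; conv_lhs => rw [hy₃']
        exact res8_add_of_eq hc0' hs1 (by rw [hvc', ← ht, htn, hsn]; push_cast; ring)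
      have hp₂ : parityBit 2 (x - (e₂ : ℚ)) = ((m' + 1 + 1 : ℕ) : ZMod 2) :=
        parityBit_two_eq_natCast (by rw [← ht, htn, hsn]; obtain ⟨i, hi⟩ := hso; exact ⟨i, by push_cast; omega⟩)
      rw [hres₁, hres₃] at hprod
      exact GOAL hp₁ hres₁ hp₂ rfl (w11_of_C2 hm hso hrr₂ hprod)
  · -- (B) `v ≥ 2`, even: the other two factors have valuation `1`
    have hv₂ : t = 1 := by
      rw [ht, hx₂', (padicValRat_add_eq_left ha0' (Or.inr (by rw [hva', ← hv]; exact_mod_cast hge2))).2, hva',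
        Nat.cast_one]
    have hv₃ : padicValRat 2 (x - (e₃ : ℚ)) = 1 := by
      rw [hx₃', (padicValRat_add_eq_left hb0' (Or.inr (by rw [hvb', ← hv]; exact_mod_cast hge2))).2, hvb',
        Nat.cast_one]
    rw [hv₂, hv₃] at hsum
    obtain ⟨j, hj⟩ := hsum
    obtain ⟨k, hk⟩ : ∃ k : ℕ, v = 1 + k := by
      obtain ⟨k, hk⟩ := Int.eq_ofNat_of_zero_le (show 0 ≤ v - 1 by omega); exact ⟨k, by omega⟩
    have hk13 : k = 1 ∨ 3 ≤ k := by omega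
    have hk1 : 1 ≤ k := by omega
    have he : (2 : ZMod (2 ^ 3)) ^ k = 2 ∨ (2 : ZMod (2 ^ 3)) ^ k = 0 := by
      rcases hk13 with rfl | h3
      · exact Or.inl rfl
      · exact Or.inr (two_pow_eq_zero_of_le h3)
    have hres₂ : res8 (x - (e₂ : ℚ)) = -a + 2 ^ k * res8 (x - (e₁ : ℚ)) := by
      rw [← hra']; conv_lhs => rw [hx₂']
      exact res8_add_of_eq ha0' hk1 (by rw [hva', ← hv, hk]; push_cast; ring)
    have hres₃ : res8 (x - (e₃ : ℚ)) = -b + 2 ^ k * res8 (x - (e₁ : ℚ)) := by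
      rw [← hrb']; conv_lhs => rw [hx₃']
      exact res8_add_of_eq hb0' hk1 (by rw [hvb', ← hv, hk]; push_cast; ring)
    rw [hres₂, hres₃] at hprod
    refine GOAL (v₁ := 0) (v₂ := 1) (by rw [Nat.cast_zero]; exact parityBit_eq_zero_iff.mpr ⟨j - 1, by omega⟩)
      rfl (parityBit_two_eq_natCast (by rw [← ht, hv₂]; simp)) hres₂ ?_
    exact w11_of_B hab he hrr₁ hprod

end Summit.BirchSwinnertonDyer.BirchSwinnertonDyer.Rank2Observatory
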